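import Mathlib.Data.Set.Function
import Mathlib.Logic.Function.Basic
import Literature.Computability.Complexity.CNF
import HarnessLib

/-!
# Relabelling the variables of a CNF (generic variable types)

Infrastructure for SAT encodings (`CardinalityCNF.lean`, the TPP encoder
`Combinatorics/Additive/TripleProductPropertySAT.lean`, the LRAT importer `LRATImport.lean`):
encoders are written over a *structured* variable type `ν` (sums and products of `Fin n`, custom
inductives) and only at the very end relabelled to `ℕ`, the variable type of DIMACS files and of
the tree's languages `SAT`/`UNSAT` (`CNF.lean`). This file provides

* `Literal.relabel`, `Clause.relabel`, `CNF.relabel f` — rename every variable along `f : ν → μ`;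
* `CNF.varSet φ : Set ν` — the variables occurring in `φ` (no `DecidableEq` needed, unlike the
  `Finset`-valued `CNF.vars` of `CNF.lean`), `CNF.eval_congr_varSet`;
* `CNF.eval_relabel` (the value of the relabelled CNF is the value under the pulled-back
  assignment) and the equisatisfiability statements `CNF.satisfiable_relabel_iff_of_injOn`
  (for `f` injective on the occurring variables) and `CNF.satisfiable_relabel_iff` (for `f`
  injective).

## Relation to existing tree declarations (deliberate twins, not imported)

`CNF.rename` / `CNF.eval_rename` (`ParsimoniousCookLevin.lean`, via `CookLevin.renLit`) and
`CNF.satisfiable_rename_iff` (`CNFInvariance.lean`) are the same statements for `ℕ → ℕ` resp. with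
the Cook–Levin tableau development in their import closure; the SAT-encoding files are kept free
of that closure (they are imported by certificate files that must elaborate fast), exactly as
`ParsimoniousCookLevin.lean` keeps a private twin of `CNF.mem_vars_iff`. The definitions agree
definitionally (`relabel f φ = φ.map (·.map fun l => (f l.1, l.2))`).

## References

Folklore (variable renaming in propositional logic); S. Arora, B. Barak, *Computational
Complexity*, CUP 2009, §2.3 (CNF formulas). [cite: AroraBarak2009, §2.3]
-/

namespace Literature.Computability.Complexity

universe u v

variable {ν : Type u} {μ : Type v}

/-! ### Relabelling -/

/-- Rename the variable of a literal along `f`, keeping the polarity. [folklore] -/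
def Literal.relabel (f : ν → μ) (l : Literal ν) : Literal μ :=
  (f l.1, l.2)

/-- Rename the variables of a clause along `f`. [folklore] -/
def Clause.relabel (f : ν → μ) (c : Clause ν) : Clause μ :=
  c.map (Literal.relabel f)

/-- Rename the variables of a CNF along `f` (definitionally the `ℕ → ℕ` twin `CNF.rename` of
`ParsimoniousCookLevin.lean`, for arbitrary variable types). [folklore] -/
def CNF.relabel (f : ν → μ) (φ : CNF ν) : CNF μ :=
  φ.map (Clause.relabel f)

/-- The variable of a relabelled literal. [folklore] -/
@[simp] theorem Literal.relabel_fst (f : ν → μ) (l : Literal ν) : (l.relabel f).1 = f l.1 := rfl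

/-- The polarity of a relabelled literal. [folklore] -/
@[simp] theorem Literal.relabel_snd (f : ν → μ) (l : Literal ν) : (l.relabel f).2 = l.2 := rfl

/-- The value of a relabelled literal is the value under the pulled-back assignment. [folklore] -/
@[simp] theorem Literal.eval_relabel (f : ν → μ) (σ : μ → Bool) (l : Literal ν) :
    (l.relabel f).eval σ = l.eval (σ ∘ f) := rfl

/-- The value of a relabelled clause is the value under the pulled-back assignment. [folklore] -/
@[simp] theorem Clause.eval_relabel (f : ν → μ) (σ : μ → Bool) (c : Clause ν) :
    (c.relabel f).eval σ = c.eval (σ ∘ f) := by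
  simp only [Clause.eval, Clause.relabel, List.any_map]
  rfl

/-- **The value of a relabelled CNF is the value under the pulled-back assignment.** [folklore] -/
@[simp] theorem CNF.eval_relabel (f : ν → μ) (φ : CNF ν) (σ : μ → Bool) :
    (φ.relabel f).eval σ = φ.eval (σ ∘ f) := by
  simp only [CNF.eval, CNF.relabel, List.all_map]
  congr 1
  funext c
  simp only [Function.comp_apply, Clause.relabel, List.any_map]
  rfl

/-- Relabelling is functorial: relabelling along `f` then `g` is relabelling along `g ∘ f`.
[folklore] -/
theorem CNF.relabel_relabel {κ : Type*} (f : ν → μ) (g : μ → κ) (φ : CNF ν) :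
    (φ.relabel f).relabel g = φ.relabel (g ∘ f) := by
  simp only [CNF.relabel, List.map_map]
  congr 1
  funext c
  simp only [Function.comp_apply, Clause.relabel, List.map_map]
  rfl

/-- The clauses of a relabelled CNF are the relabelled clauses. [folklore] -/
theorem CNF.mem_relabel_iff {f : ν → μ} {φ : CNF ν} {c : Clause μ} :
    c ∈ φ.relabel f ↔ ∃ c₀ ∈ φ, c₀.relabel f = c := by
  simp [CNF.relabel]

/-- Relabelling commutes with concatenation of CNFs (conjunction). [folklore] -/
@[simp] theorem CNF.relabel_append (f : ν → μ) (φ ψ : CNF ν) :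
    CNF.relabel f (φ ++ ψ) = φ.relabel f ++ ψ.relabel f := by
  simp [CNF.relabel]

/-! ### Occurring variables as a set -/

/-- The set of variables occurring in a CNF: `x` occurs if it is the variable of some literal of
some clause. (A `Set`, so that no decidable equality on `ν` is needed; for `DecidableEq ν` it is
the coercion of the `Finset` `CNF.vars`.) [folklore] -/
def CNF.varSet (φ : CNF ν) : Set ν :=
  {x | ∃ c ∈ φ, ∃ l ∈ c, l.1 = x}

/-- Unfolding `CNF.varSet`. [folklore] -/
theorem CNF.mem_varSet_iff {φ : CNF ν} {x : ν} : x ∈ φ.varSet ↔ ∃ c ∈ φ, ∃ l ∈ c, l.1 = x :=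
  Iff.rfl

/-- The variable of a literal of a clause of `φ` occurs in `φ`. [folklore] -/
theorem CNF.mem_varSet_of_mem {φ : CNF ν} {c : Clause ν} (hc : c ∈ φ) {l : Literal ν}
    (hl : l ∈ c) : l.1 ∈ φ.varSet :=
  ⟨c, hc, l, hl, rfl⟩

/-- `varSet` coincides with the `Finset` `vars` of `CNF.lean`. [folklore] -/
theorem CNF.mem_varSet_iff_mem_vars [DecidableEq ν] {φ : CNF ν} {x : ν} :
    x ∈ φ.varSet ↔ x ∈ φ.vars := by
  simp only [CNF.mem_varSet_iff, CNF.vars, List.mem_toFinset, List.mem_map, List.mem_flatten]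
  constructor
  · rintro ⟨c, hc, l, hl, rfl⟩
    exact ⟨l, ⟨c, hc, hl⟩, rfl⟩
  · rintro ⟨l, ⟨c, hc, hl⟩, rfl⟩
    exact ⟨c, hc, l, hl, rfl⟩

/-- The occurring variables of a concatenation. [folklore] -/
@[simp] theorem CNF.varSet_append (φ ψ : CNF ν) : CNF.varSet (φ ++ ψ) = φ.varSet ∪ ψ.varSet := by
  ext x
  simp only [CNF.mem_varSet_iff, List.mem_append, Set.mem_union]
  constructor
  · rintro ⟨c, hc | hc, l, hl, rfl⟩
    · exact Or.inl ⟨c, hc, l, hl, rfl⟩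
    · exact Or.inr ⟨c, hc, l, hl, rfl⟩
  · rintro (⟨c, hc, l, hl, rfl⟩ | ⟨c, hc, l, hl, rfl⟩)
    · exact ⟨c, Or.inl hc, l, hl, rfl⟩
    · exact ⟨c, Or.inr hc, l, hl, rfl⟩

/-- The occurring variables of a relabelled CNF are the images of the occurring variables.
[folklore] -/
theorem CNF.varSet_relabel (f : ν → μ) (φ : CNF ν) : (φ.relabel f).varSet = f '' φ.varSet := by
  ext y
  simp only [CNF.mem_varSet_iff, CNF.mem_relabel_iff, Set.mem_image]
  constructor
  · rintro ⟨c, ⟨c₀, hc₀, rfl⟩, l, hl, rfl⟩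
    obtain ⟨l₀, hl₀, rfl⟩ := List.mem_map.1 hl
    exact ⟨l₀.1, ⟨c₀, hc₀, l₀, hl₀, rfl⟩, rfl⟩
  · rintro ⟨x, ⟨c₀, hc₀, l₀, hl₀, rfl⟩, rfl⟩
    exact ⟨c₀.relabel f, ⟨c₀, hc₀, rfl⟩, l₀.relabel f, List.mem_map.2 ⟨l₀, hl₀, rfl⟩, rfl⟩

/-- The value of a CNF depends only on the values of its occurring variables. [folklore] -/
theorem CNF.eval_congr_varSet {φ : CNF ν} {σ σ' : ν → Bool} (h : ∀ x ∈ φ.varSet, σ x = σ' x) :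
    φ.eval σ = φ.eval σ' := by
  have key : ∀ c ∈ φ, ∀ l ∈ c, Literal.eval σ l = Literal.eval σ' l := fun c hc l hl => by
    simp [Literal.eval, h _ (CNF.mem_varSet_of_mem hc hl)]
  rw [Bool.eq_iff_iff, CNF.eval_eq_true_iff, CNF.eval_eq_true_iff]
  refine forall₂_congr fun c hc => ?_
  simp only [Clause.eval, List.any_eq_true]
  exact exists_congr fun l => and_congr_right fun hl => by rw [key c hc l hl]

/-! ### Equisatisfiability under relabelling -/

/-- A satisfying assignment of the relabelled CNF pulls back to one of the original. [folklore] -/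
theorem CNF.Satisfiable.of_relabel {f : ν → μ} {φ : CNF ν} (h : (φ.relabel f).Satisfiable) :
    φ.Satisfiable := by
  obtain ⟨τ, hτ⟩ := h
  exact ⟨τ ∘ f, by rwa [← CNF.eval_relabel]⟩

/-- **Relabelling along a map injective on the occurring variables preserves satisfiability**:
a satisfying assignment `σ` is pushed forward to `f x ↦ σ x` (well defined on `f '' varSet φ` by
injectivity, `false` elsewhere). [folklore] -/
theorem CNF.Satisfiable.relabel_of_injOn {f : ν → μ} {φ : CNF ν} (hf : Set.InjOn f φ.varSet)
    (h : φ.Satisfiable) : (φ.relabel f).Satisfiable := by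
  classical
  obtain ⟨σ, hσ⟩ := h
  let τ : μ → Bool := fun y => if hy : ∃ x ∈ φ.varSet, f x = y then σ hy.choose else false
  have hτ : ∀ x ∈ φ.varSet, (τ ∘ f) x = σ x := fun x hx => by
    have hy : ∃ x' ∈ φ.varSet, f x' = f x := ⟨x, hx, rfl⟩
    simp only [Function.comp_apply, τ, dif_pos hy]
    exact congrArg σ (hf hy.choose_spec.1 hx hy.choose_spec.2)
  exact ⟨τ, by rw [CNF.eval_relabel, CNF.eval_congr_varSet hτ, hσ]⟩

/-- **Equisatisfiability under relabelling**, `InjOn` form: for `f` injective on the occurring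
variables, `φ.relabel f` is satisfiable iff `φ` is. [folklore] -/
theorem CNF.satisfiable_relabel_iff_of_injOn {f : ν → μ} {φ : CNF ν}
    (hf : Set.InjOn f φ.varSet) : (φ.relabel f).Satisfiable ↔ φ.Satisfiable :=
  ⟨CNF.Satisfiable.of_relabel, CNF.Satisfiable.relabel_of_injOn hf⟩

/-- **Equisatisfiability under relabelling** along an injective map. [folklore] -/
theorem CNF.satisfiable_relabel_iff {f : ν → μ} (hf : Function.Injective f) (φ : CNF ν) :
    (φ.relabel f).Satisfiable ↔ φ.Satisfiable :=
  CNF.satisfiable_relabel_iff_of_injOn (hf.injOn)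

/-! ### Conjunction (concatenation) of CNFs -/

/-- The value of a concatenation of CNFs is the conjunction of the values. [folklore] -/
@[simp] theorem CNF.eval_append (φ ψ : CNF ν) (σ : ν → Bool) :
    CNF.eval (φ ++ ψ) σ = (φ.eval σ && ψ.eval σ) :=
  List.all_append

/-- A concatenation is true iff both parts are. [folklore] -/
theorem CNF.eval_append_eq_true_iff (φ ψ : CNF ν) (σ : ν → Bool) :
    CNF.eval (φ ++ ψ) σ = true ↔ φ.eval σ = true ∧ ψ.eval σ = true := by
  rw [CNF.eval_append, Bool.and_eq_true]

/-- The value of a flattened list of CNFs (big conjunction). [folklore] -/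
theorem CNF.eval_flatten_eq_true_iff (L : List (CNF ν)) (σ : ν → Bool) :
    CNF.eval L.flatten σ = true ↔ ∀ φ ∈ L, CNF.eval φ σ = true := by
  induction L with
  | nil => simp
  | cons φ L ih => simp [List.flatten_cons, ih]

end Literature.Computability.Complexity
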